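import Mathlib.Combinatorics.SimpleGraph.Clique
import Mathlib.Data.ZMod.Basic
import Mathlib.Data.Nat.Bitwise
import Summits.Ventures.DiscreteObjects.UnitDistance.UnitCircleGraph
import HarnessLib

/-!
# A kernel search for independent sets, and `α(UD(𝔽₇²)) = 14` (cell `pub-namedobj`, target (U), seat udg g20)

Framing (verbatim for the cell): lottery ticket; floor = certified bounds/negative ranges.

`noIndepB` is a pruned depth-first search over bitmasks (`Nat.testBit`, `&&&`), written as a structural recursion on the list of remaining
vertices and proved sound once and for all (`noIndepB_sound`): a `true` answer certifies that no independent set of the prescribed size extends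
the chosen vertices.  It is the independent-set analogue of the cell's `noColB` (`FiniteFieldLowerBoundF11.lean`) and is meant to be reused
(sub-configuration certificates `α(G[W]) ≤ a`, lift checks for the reduction tower `G_k(p)`, cf. `ReductionTowerIndependence.lean`).

APPLICATION (replication): `α(unitCircleGraph (ZMod 7)) = 14` — the independence number of the finite Euclidean ('unit-quadrance') graph
`E_7(2,1) = UD(𝔽₇²)` (49 vertices, 8-regular, triangle-free).  In print: S. M. Cioabă, PhD thesis (Queen's Univ. 2005) §4.3, table p. 55
("The lower bound of 14 for α(E_7(2,1)) is by computer search. David Gregory has proved 14 is an upper bound"); the cell had the value from two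
exact engines (udg g19, mis.c / B&B).  Here: an explicit 14-set, and the kernel search (46,472 calls; WLOG the set contains the origin, by
translation) refutes 15.  Consequently the independence ratio of `UD(𝔽₇²)` is exactly `2/7` (the Hoffman ratio is `0.3597…`), the base value of
Cioabă's lift question `α(G_k(7)) = 2·7^{2k−1}?` (`ReductionTowerIndependence.lean`).  Nothing here is cited as new mathematics.
-/

namespace Summit.Ventures.DiscreteObjects.UnitDistance

open SimpleGraph Finset

/-! ## Generic kernel search: no independent set of size `t` -/

/-- Pruned DFS (Bool).  `coMask v` = bitmask of the vertices that are NOT adjacent to `v` (and `≠ v`); state: remaining vertices `rest`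
(a duplicate-free list), number `s` of chosen vertices, and `cand`, a bitmask over-approximating the remaining vertices compatible with all
chosen ones.  `noIndepB coMask t rest s cand = true` means: no admissible extension reaches `t` vertices. -/
def noIndepB (coMask : ℕ → ℕ) (t : ℕ) : List ℕ → ℕ → ℕ → Bool
  | [], s, _ => decide (s < t)
  | v :: rest, s, cand =>
      decide (s < t) &&
      (decide (s + (v :: rest).countP (fun w => cand.testBit w) < t) ||
        ((!cand.testBit v || noIndepB coMask t rest (s + 1) (cand &&& coMask v)) && noIndepB coMask t rest s cand))

/-- Elements of a list outside a given finset and passing a Bool test: the finset of them is no larger than `countP`. -/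
theorem card_filter_toFinset_le_countP (l : List ℕ) (q : ℕ → Bool) :
    #(l.toFinset.filter fun w => q w = true) ≤ l.countP q := by
  classical
  rw [List.countP_eq_length_filter]
  calc #(l.toFinset.filter fun w => q w = true) = #((l.filter q).toFinset) := by
        congr 1; ext w; simp
    _ ≤ (l.filter q).length := List.toFinset_card_le _

/-- SOUNDNESS of `noIndepB`.  `adj` is any adjacency predicate on `ℕ`-coded vertices below `N`; `coMask` must contain every compatible
vertex (`hco`).  If the search answers `true` from a state whose candidate mask over-approximates the vertices of `rest` compatible with
`chosen`, then every `adj`-independent `S` with `chosen ⊆ S ⊆ chosen ∪ rest` has fewer than `t` elements. -/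
theorem noIndepB_sound (coMask : ℕ → ℕ) (t N : ℕ) (adj : ℕ → ℕ → Prop)
    (hco : ∀ v w : ℕ, v < N → w < N → v ≠ w → ¬ adj v w → (coMask v).testBit w = true) :
    ∀ (rest : List ℕ) (chosen : Finset ℕ) (cand : ℕ),
      rest.Nodup → (∀ w ∈ rest, w < N) → (∀ u ∈ chosen, u < N) → (∀ w ∈ rest, w ∉ chosen) →
      (∀ w ∈ rest, (∀ u ∈ chosen, ¬ adj u w) → cand.testBit w = true) →
      noIndepB coMask t rest (#chosen) cand = true →
      ∀ S : Finset ℕ, chosen ⊆ S → (∀ x ∈ S, x ∈ chosen ∨ x ∈ rest) →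
        (∀ a ∈ S, ∀ b ∈ S, a ≠ b → ¬ adj a b) → #S < t := by
  classical
  intro rest
  induction rest with
  | nil =>
    intro chosen cand _ _ _ _ _ h S hcS hS _
    have hlt : #chosen < t := by simpa [noIndepB] using h
    have hSc : S ⊆ chosen := fun x hx => by rcases hS x hx with h' | h' <;> simp_all
    rw [Finset.Subset.antisymm hSc hcS]; exact hlt
  | cons v rest ih =>
    intro chosen cand hnd hN hcN hdisj hinv h S hcS hS hind
    have hvr : v ∉ rest := (List.nodup_cons.1 hnd).1
    have hnd' : rest.Nodup := (List.nodup_cons.1 hnd).2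
    simp only [noIndepB, Bool.and_eq_true, decide_eq_true_eq, Bool.or_eq_true, Bool.not_eq_true'] at h
    obtain ⟨hst, h⟩ := h
    -- every element of S outside `chosen` lies in v :: rest and is flagged in cand
    have hout : ∀ x ∈ S, x ∉ chosen → x ∈ (v :: rest) ∧ cand.testBit x = true := by
      intro x hx hxc
      have hxr : x ∈ v :: rest := (hS x hx).resolve_left hxc
      refine ⟨hxr, hinv x hxr ?_⟩
      intro u hu
      have hux : u ≠ x := fun e => hxc (e ▸ hu)
      exact hind u (hcS hu) x hx hux
    rcases h with hprune | ⟨hinc, hexc⟩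
    · -- pruning: #S ≤ #chosen + #{flagged remaining} < t
      have hsplit : #S = #chosen + #(S \ chosen) := by
        rw [← card_union_of_disjoint disjoint_sdiff, union_sdiff_of_subset hcS]
      have hsub : S \ chosen ⊆ (v :: rest).toFinset.filter fun w => cand.testBit w = true := by
        intro x hx
        rw [mem_sdiff] at hx
        obtain ⟨hxr, hxb⟩ := hout x hx.1 hx.2
        simp only [mem_filter, List.mem_toFinset]
        exact ⟨hxr, hxb⟩
      calc #S = #chosen + #(S \ chosen) := hsplit
        _ ≤ #chosen + #((v :: rest).toFinset.filter fun w => cand.testBit w = true) :=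
            Nat.add_le_add_left (card_le_card hsub) _
        _ ≤ #chosen + (v :: rest).countP (fun w => cand.testBit w) :=
            Nat.add_le_add_left (card_filter_toFinset_le_countP _ _) _
        _ < t := hprune
    · by_cases hvS : v ∈ S
      · -- include branch
        have hvc : v ∉ chosen := hdisj v List.mem_cons_self
        have hvb : cand.testBit v = true := (hout v hvS hvc).2
        have hinc' : noIndepB coMask t rest (#chosen + 1) (cand &&& coMask v) = true := by
          rcases hinc with hf | hok
          · rw [hvb] at hf; exact absurd hf (by decide)
          · exact hok
        have hcard : #(insert v chosen) = #chosen + 1 := card_insert_of_notMem hvc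
        rw [← hcard] at hinc'
        refine ih (insert v chosen) (cand &&& coMask v) hnd' (fun w hw => hN w (List.mem_cons_of_mem _ hw))
          ?_ ?_ ?_ hinc' S ?_ ?_ hind
        · intro u hu
          rcases mem_insert.1 hu with rfl | hu
          · exact hN _ List.mem_cons_self
          · exact hcN u hu
        · intro w hw hwc
          rcases mem_insert.1 hwc with rfl | hwc
          · exact hvr hw
          · exact hdisj w (List.mem_cons_of_mem _ hw) hwc
        · intro w hw hcomp
          have h1 : cand.testBit w = true :=
            hinv w (List.mem_cons_of_mem _ hw) fun u hu => hcomp u (mem_insert_of_mem hu)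
          have hvw : v ≠ w := fun e => hvr (e ▸ hw)
          have h2 : (coMask v).testBit w = true :=
            hco v w (hN _ List.mem_cons_self) (hN w (List.mem_cons_of_mem _ hw)) hvw (hcomp v (mem_insert_self _ _))
          rw [Nat.testBit_land, h1, h2]; rfl
        · exact insert_subset hvS hcS
        · intro x hx
          rcases hS x hx with hxc | hxr
          · exact Or.inl (mem_insert_of_mem hxc)
          · rcases List.mem_cons.1 hxr with rfl | hxr
            · exact Or.inl (mem_insert_self _ _)
            · exact Or.inr hxr
      · -- exclude branch
        refine ih chosen cand hnd' (fun w hw => hN w (List.mem_cons_of_mem _ hw)) hcN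
          (fun w hw => hdisj w (List.mem_cons_of_mem _ hw))
          (fun w hw hcomp => hinv w (List.mem_cons_of_mem _ hw) hcomp) hexc S hcS ?_ hind
        intro x hx
        rcases hS x hx with hxc | hxr
        · exact Or.inl hxc
        · rcases List.mem_cons.1 hxr with rfl | hxr
          · exact absurd hx hvS
          · exact Or.inr hxr

/-! ## Application: `UD(𝔽₇²)` -/

/-- Non-adjacency bitmasks of `UD(𝔽₇²)` in the coding `(x, y) ↦ 7x + y` (vertex `7x + y` ↔ bit `7x + y`); generated by
`code/udg20/gen_f7alpha.py`, checked against the graph in `coMask7_spec`. -/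
def coMask7Table : List ℕ :=
  [557314955738940, 551679958056696, 544773651545585, 526597349669859, 490244745918407, 421903227269007, 280856501116830,
   404620203499134, 246290453593213, 488183127013627, 413416300605943, 263882647790575, 523367515408351, 483785077411647,
   562940286549851, 562930621759159, 562945381400046, 562940809378781, 562931665336251, 562947468554230, 562944985767917,
   561712593874431, 560475500665855, 562364734699391, 561779515977471, 560609078533631, 562631890434943, 562314093786879,
   404567931420671, 246220000722943, 488041957015551, 413133960609791, 263317967798271, 522237891166207, 481559920214015,
   556249460506587, 553912654364599, 544875621646318, 526801289871325, 490652626321339, 418355565559798, 278124864471021,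
   268236813757950, 532075581004797, 501235299907451, 439520646393591, 316091339365871, 69266816629599, 134135586748095]

/-- The mask function. -/
def coMask7 (v : ℕ) : ℕ := coMask7Table.getD v 0

/-- Decoding `7x + y ↦ (x, y)`. -/
def dec7 (i : ℕ) : ZMod 7 × ZMod 7 := (((i / 7 : ℕ) : ZMod 7), ((i % 7 : ℕ) : ZMod 7))

/-- Coding `(x, y) ↦ 7x + y`. -/
def enc7 (v : ZMod 7 × ZMod 7) : ℕ := 7 * v.1.val + v.2.val

/-- `dec7 ∘ enc7 = id`. -/
theorem dec7_enc7 (v : ZMod 7 × ZMod 7) : dec7 (enc7 v) = v := by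
  revert v; decide

/-- Codes are `< 49`. -/
theorem enc7_lt (v : ZMod 7 × ZMod 7) : enc7 v < 49 := by
  revert v; decide

/-- `enc7` is injective. -/
theorem enc7_injective : Function.Injective enc7 :=
  fun v w h => by simpa [dec7_enc7] using congrArg dec7 h

/-- The masks are correct: a non-adjacent pair of distinct vertices is flagged (checked in the kernel over all `49²` pairs). -/
theorem coMask7_spec : ∀ v w : ℕ, v < 49 → w < 49 → v ≠ w →
    ¬ (unitCircleGraph (ZMod 7)).Adj (dec7 v) (dec7 w) → (coMask7 v).testBit w = true := by
  have key : ∀ v : Fin 49, ∀ w : Fin 49, (v : ℕ) ≠ w →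
      ((coMask7 v).testBit w = false → (unitCircleGraph (ZMod 7)).Adj (dec7 v) (dec7 w)) := by
    unfold coMask7 dec7 unitCircleGraph; decide +kernel
  intro v w hv hw hne hnadj
  have := key ⟨v, hv⟩ ⟨w, hw⟩ hne
  by_contra hbit
  exact hnadj (this (by simpa using hbit))

set_option maxHeartbeats 40000000 in
/-- KERNEL FACT (pruned DFS, 46,472 calls): no independent set of `UD(𝔽₇²)` through the origin has `15` elements (search over the codes
`1, …, 48` from the state `chosen = {0}`, `cand = coMask7 0`). -/
theorem ud7_noIndepB : noIndepB coMask7 15 (List.range' 1 48) 1 (coMask7 0) = true := by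
  decide +kernel

/-- Translation invariance: shifting an independent set of `unitCircleGraph A` gives an independent set. -/
theorem isIndepSet_image_sub {A : Type*} [CommRing A] [DecidableEq A] (S : Finset (A × A)) (x : A × A)
    (hS : (unitCircleGraph A).IsIndepSet (S : Set (A × A))) :
    (unitCircleGraph A).IsIndepSet ((S.image fun v => v - x : Finset (A × A)) : Set (A × A)) := by
  intro a ha b hb hab hadj
  simp only [coe_image, Set.mem_image, mem_coe] at ha hb
  obtain ⟨v, hv, rfl⟩ := ha
  obtain ⟨w, hw, rfl⟩ := hb
  have hvw : v ≠ w := fun e => hab (by rw [e])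
  refine hS hv hw hvw ⟨hvw, ?_⟩
  have h2 := hadj.2
  simp only [Prod.fst_sub, Prod.snd_sub] at h2 ⊢
  have e1 : v.1 - x.1 - (w.1 - x.1) = v.1 - w.1 := by ring
  have e2 : v.2 - x.2 - (w.2 - x.2) = v.2 - w.2 := by ring
  rw [e1, e2] at h2; exact h2

/-- UPPER BOUND: every independent set of `UD(𝔽₇²)` has at most `14` elements. -/
theorem card_le_fourteen_of_isIndepSet_zmod7 (S : Finset (ZMod 7 × ZMod 7))
    (hS : (unitCircleGraph (ZMod 7)).IsIndepSet (S : Set (ZMod 7 × ZMod 7))) : #S ≤ 14 := by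
  classical
  rcases S.eq_empty_or_nonempty with rfl | ⟨x, hx⟩
  · simp
  -- translate so that the origin is in the set
  set S' : Finset (ZMod 7 × ZMod 7) := S.image fun v => v - x with hS'def
  have hS' : (unitCircleGraph (ZMod 7)).IsIndepSet (S' : Set (ZMod 7 × ZMod 7)) := isIndepSet_image_sub S x hS
  have hcardS' : #S' = #S := card_image_of_injective _ (sub_left_injective)
  have h0 : ((0, 0) : ZMod 7 × ZMod 7) ∈ S' := by
    rw [hS'def, mem_image]; exact ⟨x, hx, by ext <;> simp⟩
  -- code the vertices
  set T : Finset ℕ := S'.image enc7 with hTdef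
  have hcardT : #T = #S' := card_image_of_injective _ enc7_injective
  have hT0 : (0 : ℕ) ∈ T := by rw [hTdef, mem_image]; exact ⟨(0, 0), h0, by decide⟩
  have hTind : ∀ a ∈ T, ∀ b ∈ T, a ≠ b → ¬ (unitCircleGraph (ZMod 7)).Adj (dec7 a) (dec7 b) := by
    intro a ha b hb hab
    rw [hTdef, mem_image] at ha hb
    obtain ⟨v, hv, rfl⟩ := ha
    obtain ⟨w, hw, rfl⟩ := hb
    rw [dec7_enc7, dec7_enc7]
    have hvw : v ≠ w := fun e => hab (by rw [e])
    exact hS' hv hw hvw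
  have hTlt : ∀ a ∈ T, a < 49 := by
    intro a ha; rw [hTdef, mem_image] at ha; obtain ⟨v, -, rfl⟩ := ha; exact enc7_lt v
  have hlt : #T < 15 := by
    refine noIndepB_sound coMask7 15 49 (fun i j => (unitCircleGraph (ZMod 7)).Adj (dec7 i) (dec7 j)) coMask7_spec
      (List.range' 1 48) {0} (coMask7 0) List.nodup_range' ?_ ?_ ?_ ?_ (by simpa using ud7_noIndepB) T ?_ ?_ hTind
    · intro w hw; rw [List.mem_range'_1] at hw; omega
    · intro u hu; rw [mem_singleton] at hu; subst hu; norm_num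
    · intro w hw hw0; rw [mem_singleton] at hw0; rw [List.mem_range'_1] at hw; omega
    · intro w hw hcomp
      have hw' : 1 ≤ w ∧ w < 1 + 48 := List.mem_range'_1.1 hw
      exact coMask7_spec 0 w (by norm_num) (by omega) (by omega) (hcomp 0 (mem_singleton_self 0))
    · intro a ha; rw [mem_singleton] at ha; subst ha; exact hT0
    · intro a ha
      by_cases ha0 : a = 0
      · exact Or.inl (by rw [ha0]; exact mem_singleton_self 0)
      · right; rw [List.mem_range'_1]; have := hTlt a ha; omega
  omega

/-- LOWER BOUND: an explicit independent `14`-set of `UD(𝔽₇²)`. -/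
def indep14Zmod7 : Finset (ZMod 7 × ZMod 7) :=
  {(0, 0), (0, 2), (1, 3), (1, 5), (2, 1), (2, 6), (3, 2), (3, 4), (4, 0), (4, 5), (5, 1), (5, 3), (6, 4), (6, 6)}

/-- The `14`-set is independent and has `14` elements. -/
theorem isNIndepSet_indep14Zmod7 : (unitCircleGraph (ZMod 7)).IsNIndepSet 14 indep14Zmod7 := by
  constructor
  · rw [isIndepSet_iff]
    unfold indep14Zmod7 unitCircleGraph
    decide
  · rfl

/-- `α(UD(𝔽₇²)) = α(unitCircleGraph (ZMod 7)) = 14` (Cioabă 2005, table p. 55, Gregory's upper bound — replication in the kernel). -/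
theorem indepNum_unitCircleGraph_zmod7 : (unitCircleGraph (ZMod 7)).indepNum = 14 := by
  classical
  apply le_antisymm
  · obtain ⟨s, hs⟩ := (unitCircleGraph (ZMod 7)).exists_isNIndepSet_indepNum
    rw [← hs.card_eq]
    exact card_le_fourteen_of_isIndepSet_zmod7 s hs.isIndepSet
  · have h := isNIndepSet_indep14Zmod7.isIndepSet.card_le_indepNum
    rw [isNIndepSet_indep14Zmod7.card_eq] at h
    exact h

/-- The independence ratio of the residue plane at `7` is exactly `2/7`: `7 · α(UD(𝔽₇²)) = 2 · 49`. -/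
theorem seven_mul_indepNum_unitCircleGraph_zmod7 : 7 * (unitCircleGraph (ZMod 7)).indepNum = 2 * 49 := by
  rw [indepNum_unitCircleGraph_zmod7]

end Summit.Ventures.DiscreteObjects.UnitDistance
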